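import Literature.NumberTheory.LFunctions.KMVExactAFEAllOrdersProofs
import HarnessLib

/-!
# KMV 2000 (13)–(14) at EVERY order: the exact FIRST-moment approximate functional equation
# `Λ^{(k)}(f,½) = (1 − (−1)^k η_f) q̂^{1/2} Σ_n λ_f(n) n^{−1/2} V_k(q̂; n)`, `V_k(q̂;n) = ∫_{n/q̂}^∞ e^{−x}(log(q̂/n)+log x)^k dx`
# (helper for crux K_A `PrimeLevelFamEdge.MomentsBeyondDiagonal`, stmt-Parity-20007, stub `stub_first : SubFirst` at every `Q`)

The ∀`Q` form of `stub_first` (the first display beyond the diagonal for every even-or-odd `Q`) needs the mollified FIRST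
moments of the derivatives `Λ^{(k)}(f,½)`, `k ≥ 1`; the tree has the `Q = 1` slice only (`firstMomentBeyond_atOne`, from
Bettin's unshifted Thm 1.1). Step 1 of the ∀`Q` programme is the exact one-order AFE with the Fricke sign, proved here for
every level `N ≥ 1` and every Fricke eigen-cusp-form `w_N f = η f`, `η² = 1` (newforms by Atkin–Lehner), by the tree's
real-variable route: `Λ^{(k)}(f,½) = 2π q̂^{1/2} ∫_0^∞ G_k` (`derivLambda_eq_integral`), the Fricke flip of the head
`∫_0^{1/√N} G_k` onto the tail (`IsFrickeEigen.integral_imagAxis_Ioi_inv_mul_logPow`), and the termwise `q`-expansion of the tail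
(`hasSum_integral_Ioi_imagAxis_logWeight`, substitution `integral_Ioi_exp_comp_logWeight`):
* `integral_imagAxis_logPow_eq_tail`: `∫_0^∞ G_k = (1 − (−1)^k η) ∫_{1/√N}^∞ G_k`;
* `derivLambda_eq_tsum_tail`: `Λ^{(k)}(f,½) = 2π q̂^{1/2}(1 − (−1)^kη) Σ_n a_f(n) ∫_{1/√N}^∞ e^{−2πny}(log √N y)^k dy` (HasSum form);
* `derivLambda_eq_tsum_firstAFE`: `Λ^{(k)}(f,½) = q̂^{1/2}(1 − (−1)^kη) Σ'_n λ_f(n) n^{−1/2} ∫_{n/q̂}^∞ e^{−x}(log(q̂/n)+log x)^k dx`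
  — KMV (14) with the sign term kept exactly (KMV: «the terms involving ε_f only contribute to the remainder for M < q̂»;
  beyond the diagonal they are the Bettin-range content). In KMV's notation `ε_f = −η_f`.
Proof only; no definition; nothing about Landau–Siegel zeros; K_A NOT proved.
-/

noncomputable section

open scoped Real
open Complex Set MeasureTheory Filter CongruenceSubgroup UpperHalfPlane
open Literature.NumberTheory.EllipticCurves.ModularForms
open Literature.NumberTheory.LFunctions Literature.NumberTheory.LFunctions.KMV2000

namespace Summit.Parity.GeneralizedHardyLittlewood.Theorems.MomentsBeyondDiagonal.FirstOrderAFE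

variable {N : ℕ} [NeZero N]

/-- **Fricke: the whole axis integral is `(1 − (−1)^k η)` times its tail** beyond the self-dual point `1/√N`:
`∫_0^∞ f(iy)(log √N y)^k dy = (1 − (−1)^k η) ∫_{1/√N}^∞ f(iy)(log √N y)^k dy` for `w_N f = ηf`, `η² = 1`.
[cite: KowalskiMichelVanderKam2000, (13)–(14) p. 9] -/
theorem integral_imagAxis_logPow_eq_tail (f : CuspForm (Gamma0 N) 2) (k : ℕ) {η : ℂ}
    (hW : IsFrickeEigen N f η) (hη : η ^ 2 = 1) :
    ∫ y in Ioi (0 : ℝ), f (UpperHalfPlane.ofComplex (Complex.I * y)) * (((Real.log (Real.sqrt N * y)) ^ k : ℝ) : ℂ) =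
      (1 - (-1 : ℂ) ^ k * η) * ∫ y in Ioi ((Real.sqrt N)⁻¹ : ℝ),
        f (UpperHalfPlane.ofComplex (Complex.I * y)) * (((Real.log (Real.sqrt N * y)) ^ k : ℝ) : ℂ) := by
  set G : ℝ → ℂ := fun y ↦ f (UpperHalfPlane.ofComplex (Complex.I * y)) *
    (((Real.log (Real.sqrt N * y)) ^ k : ℝ) : ℂ) with hG
  have hint : IntegrableOn G (Ioi 0) := integrableOn_imagAxis_mul_logPow f k
  set b : ℝ := (Real.sqrt N)⁻¹ with hb_def
  have hb : 0 < b := inv_pos.mpr (Real.sqrt_pos.mpr (by exact_mod_cast NeZero.pos N))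
  have hsplit : ∫ t in Ioi (0 : ℝ), G t = (∫ t in Ioc 0 b, G t) + ∫ t in Ioi b, G t := by
    have h := intervalIntegral.integral_Ioi_sub_Ioi hint hb.le
    rw [intervalIntegral.integral_of_le hb.le] at h
    linear_combination h
  have hflip : ∫ t in Ioi b, G t = (-1) ^ k * (-η) * ∫ t in Ioc (0 : ℝ) b, G t := by
    have h := hW.integral_imagAxis_Ioi_inv_mul_logPow k hb
    rw [hb_def, inv_mul_inv_sqrt_eq] at h
    exact h
  have hu : ((-1 : ℂ) ^ k) ^ 2 = 1 := by
    rw [← pow_mul, show k * 2 = 2 * k by ring, pow_mul]; norm_num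
  show ∫ t in Ioi (0 : ℝ), G t = (1 - (-1 : ℂ) ^ k * η) * ∫ t in Ioi b, G t
  set H : ℂ := ∫ t in Ioc (0 : ℝ) b, G t
  linear_combination hsplit + ((-1 : ℂ) ^ k * η) * hflip - H * η ^ 2 * hu - H * hη

/-- **`Λ^{(k)}(f,½)` as the sign factor times the rapidly convergent tail series** (HasSum form):
`Λ^{(k)}(f,½) = 2π q̂^{1/2} (1 − (−1)^k η) Σ_n a_f(n) ∫_{1/√N}^∞ e^{−2πny}(log √N y)^k dy`.
[cite: KowalskiMichelVanderKam2000, (13)–(14) p. 9] -/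
theorem derivLambda_eq_tsum_tail (f : CuspForm (Gamma0 N) 2) (k : ℕ) {η : ℂ}
    (hfr : frickeInvolution N 2 f = η • f) (hη : η ^ 2 = 1) :
    HasSum (fun n : ℕ ↦ cuspCoeff f n *
        ((∫ v in Ioi ((Real.sqrt N)⁻¹ : ℝ), Real.exp (-(2 * Real.pi * n) * v) * (Real.log (Real.sqrt N * v)) ^ k : ℝ) : ℂ))
      (∫ v in Ioi ((Real.sqrt N)⁻¹ : ℝ), f (UpperHalfPlane.ofComplex (Complex.I * v)) *
        (((Real.log (Real.sqrt N * v)) ^ k : ℝ) : ℂ)) ∧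
    derivLambda N k f = 2 * (π : ℂ) * ((qhat N : ℝ) : ℂ) ^ (1 / 2 : ℂ) * (1 - (-1 : ℂ) ^ k * η) *
      ∑' n : ℕ, cuspCoeff f n *
        ((∫ v in Ioi ((Real.sqrt N)⁻¹ : ℝ), Real.exp (-(2 * Real.pi * n) * v) * (Real.log (Real.sqrt N * v)) ^ k : ℝ) : ℂ) := by
  have hW : IsFrickeEigen N f η := isFrickeEigen_of_frickeInvolution_eq_smul N hfr
  have hb : 0 < ((Real.sqrt N)⁻¹ : ℝ) := inv_pos.mpr (Real.sqrt_pos.mpr (by exact_mod_cast NeZero.pos N))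
  have hS := hasSum_integral_Ioi_imagAxis_logWeight f k hb
  refine ⟨hS, ?_⟩
  rw [derivLambda_eq_integral f k, integral_imagAxis_logPow_eq_tail f k hW hη, hS.tsum_eq]
  ring

/-- `2πn/√N = n/q̂` (`q̂ = √N/2π`). -/
theorem two_pi_mul_div_sqrt (n : ℕ) : 2 * π * n * (Real.sqrt N)⁻¹ = n / qhat N := by
  have hs : 0 < Real.sqrt N := Real.sqrt_pos.mpr (by exact_mod_cast NeZero.pos N)
  unfold qhat
  field_simp

/-- **KMV (14) at every order, exact**: for `w_N f = ηf`, `η² = 1`,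
`Λ^{(k)}(f,½) = q̂^{1/2} (1 − (−1)^k η) Σ'_n λ_f(n) n^{−1/2} ∫_{n/q̂}^∞ e^{−x}(log(q̂/n) + log x)^k dx`.
[cite: KowalskiMichelVanderKam2000, (13)–(14) p. 9] -/
theorem derivLambda_eq_tsum_firstAFE (f : CuspForm (Gamma0 N) 2) (k : ℕ) {η : ℂ}
    (hfr : frickeInvolution N 2 f = η • f) (hη : η ^ 2 = 1) :
    derivLambda N k f = ((qhat N : ℝ) : ℂ) ^ (1 / 2 : ℂ) * (1 - (-1 : ℂ) ^ k * η) *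
      ∑' n : ℕ, GL2Family.heckeLambda f n * (((n : ℝ) ^ (-(1 / 2 : ℝ)) : ℝ) : ℂ) *
        ((∫ x in Ioi ((n : ℝ) / qhat N), Real.exp (-x) * (Real.log (qhat N / n) + Real.log x) ^ k : ℝ) : ℂ) := by
  obtain ⟨hS, hΛ⟩ := derivLambda_eq_tsum_tail f k hfr hη
  have hb : 0 < ((Real.sqrt N)⁻¹ : ℝ) := inv_pos.mpr (Real.sqrt_pos.mpr (by exact_mod_cast NeZero.pos N))
  -- termwise: `2π · a_n · ∫_{1/√N}^∞ e^{-2πnv} w = λ_f(n) n^{-1/2} V_k(n)` (both sides `0` at `n = 0`)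
  have hterm : ∀ n : ℕ, 2 * (π : ℂ) * (cuspCoeff f n *
      ((∫ v in Ioi ((Real.sqrt N)⁻¹ : ℝ), Real.exp (-(2 * Real.pi * n) * v) * (Real.log (Real.sqrt N * v)) ^ k : ℝ) : ℂ)) =
      GL2Family.heckeLambda f n * (((n : ℝ) ^ (-(1 / 2 : ℝ)) : ℝ) : ℂ) *
        ((∫ x in Ioi ((n : ℝ) / qhat N), Real.exp (-x) * (Real.log (qhat N / n) + Real.log x) ^ k : ℝ) : ℂ) := by
    intro n
    rcases Nat.eq_zero_or_pos n with rfl | hn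
    · simp [cuspCoeff_zero one_mem_strictPeriods_Gamma0 f, heckeLambda_zero]
    have hn0 : (0 : ℝ) < n := by exact_mod_cast hn
    rw [integral_Ioi_exp_comp_logWeight hn.ne' hb (fun u ↦ u ^ k), two_pi_mul_div_sqrt,
      Bettin2017.heckeLambda_weight_two]
    have hpow : (((n : ℝ) ^ (-(1 / 2 : ℝ)) : ℝ) : ℂ) * (((n : ℝ) ^ (-(1 / 2 : ℝ)) : ℝ) : ℂ) = ((n : ℂ))⁻¹ := by
      rw [← Complex.ofReal_mul, ← Real.rpow_add hn0, show (-(1 / 2 : ℝ)) + -(1 / 2) = -1 by norm_num,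
        Real.rpow_neg_one]
      push_cast
      rfl
    have hπ : (π : ℂ) ≠ 0 := by exact_mod_cast Real.pi_pos.ne'
    have hnC : (n : ℂ) ≠ 0 := by exact_mod_cast hn.ne'
    set I : ℂ := ((∫ x in Ioi ((n : ℝ) / qhat N), Real.exp (-x) * (Real.log (qhat N / n) + Real.log x) ^ k : ℝ) : ℂ)
      with hI
    push_cast
    calc 2 * (π : ℂ) * (cuspCoeff f n * ((2 * (π : ℂ) * n)⁻¹ * I)) = cuspCoeff f n * ((n : ℂ))⁻¹ * I := by
          field_simp
      _ = _ := by rw [← hpow]; ring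
  have h2 := hS.mul_left (2 * (π : ℂ))
  have hfun : (fun n : ℕ ↦ 2 * (π : ℂ) * (cuspCoeff f n *
      ((∫ v in Ioi ((Real.sqrt N)⁻¹ : ℝ), Real.exp (-(2 * Real.pi * n) * v) * (Real.log (Real.sqrt N * v)) ^ k : ℝ) : ℂ))) =
      fun n : ℕ ↦ GL2Family.heckeLambda f n * (((n : ℝ) ^ (-(1 / 2 : ℝ)) : ℝ) : ℂ) *
        ((∫ x in Ioi ((n : ℝ) / qhat N), Real.exp (-x) * (Real.log (qhat N / n) + Real.log x) ^ k : ℝ) : ℂ) :=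
    funext hterm
  rw [hfun] at h2
  rw [hΛ, hS.tsum_eq, h2.tsum_eq]
  ring

/-- **KMV (14) at every order for newforms of any level** (`w_N f = η_f f`, `η_f = ±1` by Atkin–Lehner).
[cite: KowalskiMichelVanderKam2000, (13)–(14) p. 9] -/
theorem derivLambda_eq_tsum_firstAFE_of_mem_newforms0 (f : CuspForm (Gamma0 N) 2) (hf : f ∈ newforms0 N 2) (k : ℕ) :
    derivLambda N k f = ((qhat N : ℝ) : ℂ) ^ (1 / 2 : ℂ) * (1 - (-1 : ℂ) ^ k * frickeEigenvalue f) *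
      ∑' n : ℕ, GL2Family.heckeLambda f n * (((n : ℝ) ^ (-(1 / 2 : ℝ)) : ℝ) : ℂ) *
        ((∫ x in Ioi ((n : ℝ) / qhat N), Real.exp (-x) * (Real.log (qhat N / n) + Real.log x) ^ k : ℝ) : ℂ) := by
  have hfr : frickeInvolution N 2 f = frickeEigenvalue f • f := IsNewform0.frickeInvolution_eq_smul_holds hf
  have hε : frickeEigenvalue f ^ 2 = 1 := by
    rcases IsNewform0.frickeEigenvalue_eq_one_or_eq_neg_one_holds (N := N) (k := (2 : ℤ)) hf with h | h <;>
      rw [h] <;> norm_num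
  exact derivLambda_eq_tsum_firstAFE f k hfr hε

end Summit.Parity.GeneralizedHardyLittlewood.Theorems.MomentsBeyondDiagonal.FirstOrderAFE

end
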